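import Mathlib.Analysis.SpecialFunctions.Trigonometric.Basic
import Mathlib.Analysis.SpecialFunctions.Complex.CircleAddChar
import Mathlib.Algebra.BigOperators.Field
import Mathlib.RingTheory.RootsOfUnity.Complex
import Mathlib.RingTheory.Polynomial.Cyclotomic.Roots
import Mathlib.FieldTheory.IsAlgClosed.Basic
import Mathlib.Analysis.Complex.Polynomial.Basic
import Summits.HodgeConjecture.HodgeConjecture.Theorems.Ring2WeilCoverageCMTypeSetOddPositions
import Summits.HodgeConjecture.HodgeConjecture.Theorems.Ring2WeilCoverageCMTypeSignParity
import HarnessLib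

/-!
# Weil-type family coverage — (F0): the SIGN of `Im(μ^{g−1}/Φₙ′(μ))` at the primitive `n`-th roots of unity
# `μ = 𝐞(t) = exp(2πit/n)` is `−(−1)^{below t}`; i.e. the census's sign set `N` IS the odd-position set `N_odd`

research route conditional on HC_CM; not a corollary; Q11.4-sentence-2 already refuted in dim ≥ 3.

Ring 2, WEIL-TYPE FAMILY-COVERAGE CENSUS (`HOME/WEIL-FAMILY-COVERAGE.md` `## b01`, blocks b01.23 Step 1
«alternation» and b01.28 THEOREM F **(F0)**, owner ring2-b01), part 6 of the `Ring2WeilCoverage*` series.  Parts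
1–5 (`…CMTypeSignParity`, `…CMUnitSignature`, `…CMTypeSignParityLevel21`, `…CMTypeSetPairCount`,
`…CMTypeSetOddPositions`) proved the census's polarisation mechanism with the set `N = {σ_t : Im σ_t(ξ₀) < 0}`,
`ξ₀ = ζ^{g−1}/Φ′_M(ζ)`, entering only through its COMBINATORIAL description `N_odd` = «the unit residues at odd
positions of `0 < u₁ < u₂ < … < u_{2g} < M`» (`below t := #{s ∈ (ℤ/M)ˣ : s < t}` even) — the identification
(F0) `N = N_odd` was the one ANALYTIC input left unproved there.  This file proves it, as a statement about
explicit complex numbers (no number field enters; the transfer to the embeddings of `ℚ(ζ_M)` is part 7,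
`Ring2WeilCoverageCyclotomicPrincipalObstruction`).  With `𝐞(t) = exp(2πi t/n)` (`ZMod.toCircle`),
`U = (ℤ/n)ˣ ⊆ ℤ/n`, `|U| = φ(n) = 2g`:

* §1 `primitiveRoots_eq_image_toCircle`: the primitive `n`-th roots of unity in `ℂ` are the `𝐞(t)`, `t ∈ U`;
  `card_unitsFilter_eq_totient`: `|U| = φ(n)`.
* §2 **Euler** `eval_derivative_cyclotomic_eq_prod` / `…_toCircle`: `Φₙ′(μ) = ∏_{μ′ ≠ μ} (μ − μ′)` over the
  primitive roots `μ′ ≠ μ` (Mathlib `Polynomial.Splits.eval_root_derivative` on `Φₙ = ∏ (X − μ′)`), i.e.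
  `Φₙ′(𝐞(t)) = ∏_{s ∈ U, s ≠ t} (𝐞(t) − 𝐞(s))`.
* §3 `two_mul_sum_val_unitsFilter` (**`2·Σ_{s∈U} s = |U|·n`**, pairing `s ↔ n − s`) and `prod_halfPhase`
  (`∏_{s∈U} e^{iπs/n} = (−1)^g`).
* §4 the trigonometric factorisation `toCircle_sub_toCircle`: `𝐞(t) − 𝐞(s) = e^{iπt/n}·e^{iπs/n}·2i·sin(π(t−s)/n)`,
  and **the main identity `prod_toCircle_sub_toCircle`:
  `Φₙ′(𝐞(t)) = ∏_{s ≠ t}(𝐞(t) − 𝐞(s)) = −𝐞(t)^{g−1}·2^{2g−1}·i·P_t`, `P_t := ∏_{s ≠ t} sin(π(t − s)/n) ∈ ℝ`**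
  (census b01.28 (F0): «`σ_t(ξ₀) = i/(2^{2g−1}·P_t)`»).
* §5 signs: `sin(π(t−s)/n) < 0 ↔ t < s` for unit residues `s ≠ t` (arguments in `(−π, π)`), hence
  (`prod_sin_neg_iff`, by part 1's `prod_pos_iff_even_card_filter_neg` and part 5's
  `below t + 1 + #{s : t < s} = |U|`) **`P_t < 0 ↔ below t` even**, and the conclusion
  **`im_toCircle_pow_mul_inv_prod_neg_iff`: `Im(𝐞(t)^{g−1}/Φₙ′(𝐞(t))) < 0 ↔ Even (below t)`** —
  (F0): `N = N_odd` («sign `Im σ_t(ξ₀) = sign P_t = (−1)^{#{s ∈ U : s > t}}`»).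

HONEST FRAMING: elementary trigonometry and counting on `ℂ` and `(ℤ/n)ˣ`; valid for every `n > 1` with `|U|`
even (all `n > 2`); nothing here mentions a number field, a lattice, a polarisation, Hodge classes or HC;
`HC_CM` is used nowhere.  No `def` (local notation only), no named fact, no `sorry`.

References: the census block b01.28 (F0) (seat-derived); Euler's formula for `Φₙ′` at a root and
`Gal(ℚ(ζₙ)/ℚ) ≅ (ℤ/n)ˣ` are [folklore] / [cite: Washington1997, Thm. 2.5]; the residue conventions
`σ_t : ζ ↦ ζᵗ`, `ρ = σ₋₁` are [cite: Aoki2002CMFermatType, §1 (p. 102)].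
-/

noncomputable section

open Complex Polynomial Finset
open scoped Real

namespace Summit.HodgeConjecture.Ring2WeilCoverage.CyclotomicSkewSigns

open Summit.HodgeConjecture.Ring2WeilCoverage.CMTypeSetPairCount (coprime_val_neg)
open Summit.HodgeConjecture.Ring2WeilCoverage.CMTypeSetOddPositions (val_neg_of_coprime card_below_add)
open Summit.HodgeConjecture.Ring2WeilCoverage.CMTypeSignParity (prod_pos_iff_even_card_filter_neg)

variable {n : ℕ} [NeZero n]

/-- The unit residues `(ℤ/n)ˣ ⊆ ℤ/n` (as a `Finset`; the `𝑈` of part 5). -/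
local notation3 (prettyPrint := false) "𝑈" =>
  (Finset.univ.filter fun t : ZMod n => t.val.Coprime n)

/-- `below t` = the number of unit residues below `t` (position of `t` minus one), as in part 5. -/
local notation3 (prettyPrint := false) "below " t:max =>
  (Finset.card (Finset.filter (fun s : ZMod n => s.val.Coprime n ∧ s.val < ZMod.val t) Finset.univ))

/-- `𝐞(t) = exp(2πi t/n) ∈ ℂ` (`ZMod.toCircle`). -/
local notation3 (prettyPrint := false) "𝐞 " t:max => ((ZMod.toCircle t : Circle) : ℂ)

/-- the half phase `𝐯(t) = exp(iπ t/n)`, `𝐯(t)² = 𝐞(t)`. -/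
local notation3 (prettyPrint := false) "𝐯 " t:max => cexp (π * ((ZMod.val t : ℕ) : ℂ) / (n : ℂ) * I)

/-! ### §1 Primitive roots of unity in `ℂ` read on unit residues -/

/-- `𝐞(t) = exp(2πi t/n)`.
research route conditional on HC_CM; not a corollary; Q11.4-sentence-2 already refuted in dim ≥ 3. [folklore] -/
theorem toCircle_coe_eq_exp (t : ZMod n) : 𝐞 t = cexp (2 * π * I * ((t.val : ℂ) / (n : ℂ))) := by
  rw [ZMod.toCircle_apply, mul_div_assoc]

/-- `t ↦ 𝐞(t)` is injective on `ℤ/n`.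
research route conditional on HC_CM; not a corollary; Q11.4-sentence-2 already refuted in dim ≥ 3. [folklore] -/
theorem toCircle_coe_injective : Function.Injective fun t : ZMod n => 𝐞 t :=
  fun _ _ h => ZMod.injective_toCircle (Circle.ext h)

/-- **The primitive `n`-th roots of unity in `ℂ` are the `𝐞(t)`, `t ∈ (ℤ/n)ˣ`** (Mathlib
`Complex.isPrimitiveRoot_iff`).
research route conditional on HC_CM; not a corollary; Q11.4-sentence-2 already refuted in dim ≥ 3. [cite: Washington1997, Thm. 2.5] -/
theorem primitiveRoots_eq_image_toCircle :
    primitiveRoots n ℂ = Finset.image (fun t : ZMod n => 𝐞 t) 𝑈 := by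
  ext μ
  rw [mem_primitiveRoots (NeZero.pos n), mem_image, Complex.isPrimitiveRoot_iff _ _ (NeZero.ne n)]
  constructor
  · rintro ⟨i, hi, hcop, rfl⟩
    refine ⟨(i : ZMod n), mem_filter.mpr ⟨mem_univ _, by rwa [ZMod.val_cast_of_lt hi]⟩, ?_⟩
    rw [toCircle_coe_eq_exp, ZMod.val_cast_of_lt hi]
  · rintro ⟨t, ht, rfl⟩
    exact ⟨t.val, ZMod.val_lt t, (mem_filter.mp ht).2, by rw [toCircle_coe_eq_exp]⟩

/-- **`|(ℤ/n)ˣ| = φ(n)`** for the finite set of unit residues (Mathlib `Complex.card_primitiveRoots` through §1's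
bijection; equivalently `ZMod.card_units_eq_totient`).
research route conditional on HC_CM; not a corollary; Q11.4-sentence-2 already refuted in dim ≥ 3. [cite: Washington1997, Thm. 2.5] -/
theorem card_unitsFilter_eq_totient : (𝑈).card = Nat.totient n := by
  rw [← Complex.card_primitiveRoots, primitiveRoots_eq_image_toCircle,
    Finset.card_image_of_injective _ toCircle_coe_injective]

/-! ### §2 Euler: `Φₙ′(μ) = ∏_{μ′ ≠ μ} (μ − μ′)` -/

/-- **`Φₙ′(μ) = ∏_{μ′ ≠ μ} (μ − μ′)`** over the primitive `n`-th roots `μ′ ≠ μ` in `ℂ`, for a primitive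
`n`-th root `μ` (`Φₙ = ∏_{μ′} (X − μ′)` splits with simple roots).
research route conditional on HC_CM; not a corollary; Q11.4-sentence-2 already refuted in dim ≥ 3. [folklore] -/
theorem eval_derivative_cyclotomic_eq_prod {μ : ℂ} (hμ : μ ∈ primitiveRoots n ℂ) :
    eval μ (derivative (cyclotomic n ℂ)) = ∏ μ' ∈ (primitiveRoots n ℂ).erase μ, (μ - μ') := by
  classical
  have hroots : (cyclotomic n ℂ).roots = (primitiveRoots n ℂ).val :=
    cyclotomic.roots_eq_primitiveRoots_val
  have hμr : μ ∈ (cyclotomic n ℂ).roots := by rw [hroots]; exact hμ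
  rw [Polynomial.Splits.eval_root_derivative (IsAlgClosed.splits _) (cyclotomic.monic n ℂ) hμr, hroots,
    ← Finset.erase_val, Finset.prod_eq_multiset_prod]

/-- **`Φₙ′(𝐞(t)) = ∏_{s ∈ (ℤ/n)ˣ, s ≠ t} (𝐞(t) − 𝐞(s))`** for a unit residue `t`.
research route conditional on HC_CM; not a corollary; Q11.4-sentence-2 already refuted in dim ≥ 3. [folklore] -/
theorem eval_derivative_cyclotomic_toCircle {t : ZMod n} (ht : t.val.Coprime n) :
    eval (𝐞 t) (derivative (cyclotomic n ℂ)) = ∏ s ∈ (𝑈).erase t, (𝐞 t - 𝐞 s) := by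
  classical
  have hmem : 𝐞 t ∈ primitiveRoots n ℂ := by
    rw [primitiveRoots_eq_image_toCircle]
    exact mem_image_of_mem _ (mem_filter.mpr ⟨mem_univ _, ht⟩)
  rw [eval_derivative_cyclotomic_eq_prod hmem, primitiveRoots_eq_image_toCircle,
    ← Finset.image_erase toCircle_coe_injective, Finset.prod_image fun _ _ _ _ h => toCircle_coe_injective h]

/-! ### §3 `2·Σ_{s ∈ (ℤ/n)ˣ} s = |(ℤ/n)ˣ|·n` and the product of the half phases -/

/-- **`2·Σ_{s ∈ (ℤ/n)ˣ} s = |(ℤ/n)ˣ|·n`** (`n > 1`): pair `s` with `−s = n − s` (census b01.28 (F0):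
«`Σ_{s∈U} s = gM`»).
research route conditional on HC_CM; not a corollary; Q11.4-sentence-2 already refuted in dim ≥ 3. [folklore] -/
theorem two_mul_sum_val_unitsFilter (hn : 1 < n) : 2 * ∑ s ∈ 𝑈, s.val = (𝑈).card * n := by
  have h1 : ∑ s ∈ 𝑈, (-s).val = ∑ s ∈ 𝑈, s.val := by
    refine Finset.sum_nbij' (fun s => -s) (fun s => -s) ?_ ?_ ?_ ?_ ?_
    · intro a ha; exact mem_filter.mpr ⟨mem_univ _, coprime_val_neg (mem_filter.mp ha).2⟩
    · intro a ha; exact mem_filter.mpr ⟨mem_univ _, coprime_val_neg (mem_filter.mp ha).2⟩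
    · intro a _; exact neg_neg a
    · intro a _; exact neg_neg a
    · intro a _; rfl
  have h2 : ∑ s ∈ 𝑈, ((-s).val + s.val) = ∑ s ∈ 𝑈, n :=
    Finset.sum_congr rfl fun s hs => by
      rw [val_neg_of_coprime hn (mem_filter.mp hs).2]
      have := ZMod.val_lt s
      omega
  rw [Finset.sum_add_distrib, h1, Finset.sum_const, smul_eq_mul] at h2
  omega

/-- **`∏_{s ∈ (ℤ/n)ˣ} e^{iπs/n} = (−1)^g`** when `|(ℤ/n)ˣ| = 2g` (`= exp(iπ·Σs/n) = exp(iπg)`).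
research route conditional on HC_CM; not a corollary; Q11.4-sentence-2 already refuted in dim ≥ 3. [folklore] -/
theorem prod_halfPhase (hn : 1 < n) {g : ℕ} (hg : (𝑈).card = 2 * g) : ∏ s ∈ 𝑈, 𝐯 s = (-1) ^ g := by
  rw [← Complex.exp_sum]
  have hsum : ∑ s ∈ 𝑈, (π * ((ZMod.val s : ℕ) : ℂ) / (n : ℂ) * I) =
      π * (((∑ s ∈ 𝑈, s.val : ℕ) : ℂ)) / (n : ℂ) * I := by
    push_cast
    rw [Finset.mul_sum, Finset.sum_div, Finset.sum_mul]
  have h2 := two_mul_sum_val_unitsFilter (n := n) hn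
  rw [hg] at h2
  have hs : ∑ s ∈ 𝑈, s.val = g * n := Nat.eq_of_mul_eq_mul_left two_pos (by rw [h2]; ring)
  rw [hsum, hs, ← Complex.exp_pi_mul_I, ← Complex.exp_nat_mul]
  congr 1
  have hn0 : (n : ℂ) ≠ 0 := Nat.cast_ne_zero.mpr (by omega)
  field_simp
  push_cast
  ring

/-! ### §4 The trigonometric factorisation and the main identity -/

/-- `2i·sin z = e^{iz} − e^{−iz}`.
research route conditional on HC_CM; not a corollary; Q11.4-sentence-2 already refuted in dim ≥ 3. [folklore] -/
theorem two_mul_I_mul_sin (z : ℂ) : 2 * I * Complex.sin z = cexp (z * I) - cexp (-z * I) := by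
  rw [Complex.sin]
  ring_nf
  rw [Complex.I_sq]
  ring

/-- `𝐞(t) = 𝐯(t)²`.
research route conditional on HC_CM; not a corollary; Q11.4-sentence-2 already refuted in dim ≥ 3. [folklore] -/
theorem toCircle_coe_eq_halfPhase_sq (t : ZMod n) : 𝐞 t = (𝐯 t) ^ 2 := by
  rw [toCircle_coe_eq_exp, sq, ← Complex.exp_add]
  congr 1
  ring

/-- **`𝐞(t) − 𝐞(s) = 𝐯(t)·𝐯(s)·2i·sin(π(t−s)/n)`** (`ζᵗ − ζˢ = e^{iπ(t+s)/M}·2i·sin(π(t−s)/M)`, census (F0)).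
research route conditional on HC_CM; not a corollary; Q11.4-sentence-2 already refuted in dim ≥ 3. [folklore] -/
theorem toCircle_sub_toCircle (t s : ZMod n) :
    𝐞 t - 𝐞 s = 𝐯 t * 𝐯 s * (2 * I * Complex.sin (π * ((t.val : ℂ) - (s.val : ℂ)) / (n : ℂ))) := by
  rw [two_mul_I_mul_sin, mul_sub, ← Complex.exp_add, ← Complex.exp_add, ← Complex.exp_add,
    toCircle_coe_eq_exp, toCircle_coe_eq_exp]
  congr 1 <;> (congr 1; ring)

/-- `(−1)^{k+1}·(2i)^{2k+1} = −2^{2k+1}·i`.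
research route conditional on HC_CM; not a corollary; Q11.4-sentence-2 already refuted in dim ≥ 3. [folklore] -/
theorem neg_one_pow_mul_two_I_pow (k : ℕ) :
    ((-1 : ℂ) ^ (k + 1)) * (2 * I) ^ (2 * k + 1) = -(2 ^ (2 * k + 1) * I) := by
  induction k with
  | zero => simp
  | succ k ih =>
    have e1 : 2 * (k + 1) + 1 = (2 * k + 1) + 2 := by ring
    rw [e1, pow_succ (-1 : ℂ) (k + 1), pow_add (2 * I), pow_add (2 : ℂ)]
    calc (-1) ^ (k + 1) * -1 * ((2 * I) ^ (2 * k + 1) * (2 * I) ^ 2)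
        = -(((-1 : ℂ) ^ (k + 1) * (2 * I) ^ (2 * k + 1)) * (2 * I) ^ 2) := by ring
      _ = _ := by rw [ih, mul_pow, Complex.I_sq]; ring

/-- **MAIN IDENTITY (census b01.28 (F0)): `Φₙ′(𝐞(t)) = ∏_{s ≠ t}(𝐞(t) − 𝐞(s)) = −𝐞(t)^{g−1}·2^{2g−1}·i·P_t`,
`P_t = ∏_{s ∈ (ℤ/n)ˣ, s ≠ t} sin(π(t − s)/n) ∈ ℝ`**, when `|(ℤ/n)ˣ| = 2g`, `g = k + 1`, `t` a unit residue.
(Factorise each `𝐞(t) − 𝐞(s)` by §4; the phases multiply to `𝐯(t)^{2g−2}·∏_{s∈U} 𝐯(s) = 𝐞(t)^{g−1}·(−1)^g` by §3.)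
research route conditional on HC_CM; not a corollary; Q11.4-sentence-2 already refuted in dim ≥ 3. [folklore] -/
theorem prod_toCircle_sub_toCircle (hn : 1 < n) {k : ℕ} (hg : (𝑈).card = 2 * (k + 1)) {t : ZMod n}
    (ht : t ∈ 𝑈) :
    ∏ s ∈ (𝑈).erase t, (𝐞 t - 𝐞 s) =
      -((𝐞 t) ^ k * (2 ^ (2 * k + 1) * I) *
        ((∏ s ∈ (𝑈).erase t, Real.sin (π * ((t.val : ℝ) - (s.val : ℝ)) / n) : ℝ) : ℂ)) := by
  have hcard : ((𝑈).erase t).card = 2 * k + 1 := by rw [Finset.card_erase_of_mem ht, hg]; omega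
  simp_rw [toCircle_sub_toCircle]
  rw [Finset.prod_mul_distrib, Finset.prod_mul_distrib, Finset.prod_mul_distrib, Finset.prod_const,
    Finset.prod_const, hcard]
  have h1 : (𝐯 t) ^ (2 * k + 1) * ∏ s ∈ (𝑈).erase t, 𝐯 s = (𝐞 t) ^ k * (-1) ^ (k + 1) := by
    rw [← prod_halfPhase hn hg, ← Finset.mul_prod_erase 𝑈 (fun s => 𝐯 s) ht, toCircle_coe_eq_halfPhase_sq,
      ← pow_mul]
    ring
  have h2 : ∏ s ∈ (𝑈).erase t, Complex.sin (π * ((t.val : ℂ) - (s.val : ℂ)) / (n : ℂ)) =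
      ((∏ s ∈ (𝑈).erase t, Real.sin (π * ((t.val : ℝ) - (s.val : ℝ)) / n) : ℝ) : ℂ) := by
    push_cast
    rfl
  rw [h2, h1]
  calc (𝐞 t) ^ k * (-1) ^ (k + 1) * ((2 * I) ^ (2 * k + 1) *
        ((∏ s ∈ (𝑈).erase t, Real.sin (π * ((t.val : ℝ) - (s.val : ℝ)) / n) : ℝ) : ℂ))
      = (𝐞 t) ^ k * (((-1 : ℂ) ^ (k + 1)) * (2 * I) ^ (2 * k + 1)) *
        ((∏ s ∈ (𝑈).erase t, Real.sin (π * ((t.val : ℝ) - (s.val : ℝ)) / n) : ℝ) : ℂ) := by ring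
    _ = _ := by rw [neg_one_pow_mul_two_I_pow]; ring

/-! ### §5 Signs: `P_t < 0 ↔ below t` even, and (F0) -/

/-- **Sign of one sine factor**: for unit residues `s ≠ t` (representatives in `(0, n)`, so the argument
`π(t − s)/n` lies in `(−π, π) ∖ {0}`): `sin(π(t−s)/n) < 0 ↔ t < s`, and the factor is non-zero.
research route conditional on HC_CM; not a corollary; Q11.4-sentence-2 already refuted in dim ≥ 3. [folklore] -/
theorem sin_neg_iff_val_lt {t s : ZMod n} (hst : s ≠ t) :
    (Real.sin (π * ((t.val : ℝ) - (s.val : ℝ)) / n) < 0 ↔ t.val < s.val) ∧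
      Real.sin (π * ((t.val : ℝ) - (s.val : ℝ)) / n) ≠ 0 := by
  have hn : (0 : ℝ) < n := Nat.cast_pos.mpr (NeZero.pos n)
  have ht := ZMod.val_lt t
  have hs := ZMod.val_lt s
  have hne : s.val ≠ t.val := fun h => hst (ZMod.val_injective n h)
  rcases Nat.lt_or_gt_of_ne hne with hlt | hlt
  · -- `s < t`: argument in `(0, π)`
    have h1 : 0 < π * ((t.val : ℝ) - (s.val : ℝ)) / n := by
      apply div_pos (mul_pos Real.pi_pos _) hn
      have : (s.val : ℝ) < t.val := Nat.cast_lt.mpr hlt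
      linarith
    have h2 : π * ((t.val : ℝ) - (s.val : ℝ)) / n < π := by
      rw [div_lt_iff₀ hn]
      have : (t.val : ℝ) - (s.val : ℝ) < n := by
        have : (t.val : ℝ) < n := Nat.cast_lt.mpr ht
        have : (0 : ℝ) ≤ s.val := Nat.cast_nonneg _
        linarith
      nlinarith [Real.pi_pos]
    have hpos := Real.sin_pos_of_pos_of_lt_pi h1 h2
    exact ⟨⟨fun h => absurd h (not_lt.mpr hpos.le), fun h => absurd hlt (not_lt.mpr h.le)⟩, hpos.ne'⟩
  · -- `t < s`: argument in `(−π, 0)`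
    have h1 : π * ((t.val : ℝ) - (s.val : ℝ)) / n < 0 := by
      apply div_neg_of_neg_of_pos (mul_neg_of_pos_of_neg Real.pi_pos _) hn
      have : (t.val : ℝ) < s.val := Nat.cast_lt.mpr hlt
      linarith
    have h2 : -π < π * ((t.val : ℝ) - (s.val : ℝ)) / n := by
      rw [lt_div_iff₀ hn]
      have : -(n : ℝ) < (t.val : ℝ) - (s.val : ℝ) := by
        have : (s.val : ℝ) < n := Nat.cast_lt.mpr hs
        have : (0 : ℝ) ≤ t.val := Nat.cast_nonneg _
        linarith
      nlinarith [Real.pi_pos]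
    have hneg := Real.sin_neg_of_neg_of_neg_pi_lt h1 h2
    exact ⟨⟨fun _ => hlt, fun _ => hneg⟩, hneg.ne⟩

/-- **Sign of `P_t = ∏_{s ≠ t} sin(π(t−s)/n)`: `P_t < 0 ↔ below t` is even** (and `P_t ≠ 0`), when
`|(ℤ/n)ˣ| = 2g`: the negative factors are the `|U| − 1 − below t = 2g − 1 − below t` units ABOVE `t`
(census (F0): «`sign P_t = (−1)^{#{s ∈ U : s > t}} = (−1)^{pos(t)}`»).
research route conditional on HC_CM; not a corollary; Q11.4-sentence-2 already refuted in dim ≥ 3. [folklore] -/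
theorem prod_sin_neg_iff {k : ℕ} (hg : (𝑈).card = 2 * (k + 1)) {t : ZMod n} (ht : t ∈ 𝑈) :
    (∏ s ∈ (𝑈).erase t, Real.sin (π * ((t.val : ℝ) - (s.val : ℝ)) / n) < 0 ↔ Even (below t)) ∧
      ∏ s ∈ (𝑈).erase t, Real.sin (π * ((t.val : ℝ) - (s.val : ℝ)) / n) ≠ 0 := by
  have hne : ∀ s ∈ (𝑈).erase t, Real.sin (π * ((t.val : ℝ) - (s.val : ℝ)) / n) ≠ 0 :=
    fun s hs => (sin_neg_iff_val_lt (Finset.mem_erase.mp hs).1).2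
  have hP : ∏ s ∈ (𝑈).erase t, Real.sin (π * ((t.val : ℝ) - (s.val : ℝ)) / n) ≠ 0 :=
    Finset.prod_ne_zero_iff.mpr hne
  refine ⟨?_, hP⟩
  have hpos := prod_pos_iff_even_card_filter_neg ((𝑈).erase t)
    (fun s => Real.sin (π * ((t.val : ℝ) - (s.val : ℝ)) / n)) hne
  have hfilter : ((𝑈).erase t).filter (fun s => Real.sin (π * ((t.val : ℝ) - (s.val : ℝ)) / n) < 0) =
      Finset.univ.filter fun s : ZMod n => s.val.Coprime n ∧ t.val < s.val := by
    ext s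
    simp only [Finset.mem_filter, Finset.mem_erase, Finset.mem_univ, true_and]
    constructor
    · rintro ⟨⟨hst, hs⟩, hlt⟩
      exact ⟨hs, (sin_neg_iff_val_lt hst).1.mp hlt⟩
    · rintro ⟨hs, hlt⟩
      have hst : s ≠ t := fun h => by rw [h] at hlt; exact lt_irrefl _ hlt
      exact ⟨⟨hst, hs⟩, (sin_neg_iff_val_lt hst).1.mpr hlt⟩
  rw [hfilter] at hpos
  have hsum := card_below_add t (Finset.mem_filter.mp ht).2
  rw [hg] at hsum
  constructor
  · intro hneg
    have hnot : ¬ Even (Finset.univ.filter fun s : ZMod n => s.val.Coprime n ∧ t.val < s.val).card :=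
      fun h => (lt_asymm hneg) (hpos.mpr h)
    rw [Nat.not_even_iff_odd] at hnot
    rcases hnot with ⟨a, ha⟩
    exact ⟨k - a, by omega⟩
  · rintro ⟨a, ha⟩
    have hodd : ¬ Even (Finset.univ.filter fun s : ZMod n => s.val.Coprime n ∧ t.val < s.val).card := by
      rw [Nat.not_even_iff_odd]; exact ⟨k - a, by omega⟩
    exact lt_of_le_of_ne (not_lt.mp fun h => hodd (hpos.mp h)) hP

/-- **`𝐞(t)^{g−1}·Φₙ′(𝐞(t))⁻¹ = i·(2^{2g−1}·P_t)⁻¹`** (census (F0): «`σ_t(ξ₀) = i/(2^{2g−1}·P_t)`» — purely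
imaginary).
research route conditional on HC_CM; not a corollary; Q11.4-sentence-2 already refuted in dim ≥ 3. [folklore] -/
theorem toCircle_pow_mul_inv_prod (hn : 1 < n) {k : ℕ} (hg : (𝑈).card = 2 * (k + 1)) {t : ZMod n}
    (ht : t ∈ 𝑈) :
    (𝐞 t) ^ k * (∏ s ∈ (𝑈).erase t, (𝐞 t - 𝐞 s))⁻¹ =
      I * (((2 ^ (2 * k + 1) *
        ∏ s ∈ (𝑈).erase t, Real.sin (π * ((t.val : ℝ) - (s.val : ℝ)) / n))⁻¹ : ℝ) : ℂ) := by
  rw [prod_toCircle_sub_toCircle hn hg ht]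
  have he : (𝐞 t) ^ k ≠ 0 := pow_ne_zero _ (Circle.coe_ne_zero _)
  have hP := (prod_sin_neg_iff hg ht).2
  have hPc : ((∏ s ∈ (𝑈).erase t, Real.sin (π * ((t.val : ℝ) - (s.val : ℝ)) / n) : ℝ) : ℂ) ≠ 0 :=
    Complex.ofReal_ne_zero.mpr hP
  push_cast
  field_simp
  rw [Complex.I_sq]
  ring

/-- **(F0) — THE CENSUS'S SIGN SET IS `N_odd`: `Im(𝐞(t)^{g−1}/Φₙ′(𝐞(t))) < 0 ↔ below t` is even**
(`|(ℤ/n)ˣ| = 2g = 2(k+1)`, `t` a unit residue; the value is `1/(2^{2g−1}·P_t)` with `sign P_t = −(−1)^{below t}`).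
Census b01.23 Step 1 «alternation» / b01.28 THEOREM F (F0) «`N = {u₁, u₃, u₅, …}` (odd positions)».
research route conditional on HC_CM; not a corollary; Q11.4-sentence-2 already refuted in dim ≥ 3. [folklore] -/
theorem im_toCircle_pow_mul_inv_prod_neg_iff (hn : 1 < n) {k : ℕ} (hg : (𝑈).card = 2 * (k + 1))
    {t : ZMod n} (ht : t ∈ 𝑈) :
    ((𝐞 t) ^ k * (∏ s ∈ (𝑈).erase t, (𝐞 t - 𝐞 s))⁻¹).im < 0 ↔ Even (below t) := by
  rw [toCircle_pow_mul_inv_prod hn hg ht, Complex.I_mul_im, Complex.ofReal_re, inv_lt_zero,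
    ← (prod_sin_neg_iff hg ht).1]
  constructor
  · intro h
    by_contra hle
    exact absurd h (not_lt.mpr (mul_nonneg (by positivity) (not_lt.mp hle)))
  · intro h
    exact mul_neg_of_pos_of_neg (by positivity) h

/-- **(F0) at a primitive root, through Euler's formula**: for a unit residue `t`,
`Im(𝐞(t)^{g−1}·Φₙ′(𝐞(t))⁻¹) < 0 ↔ below t` even, with `Φₙ′` the derivative of the complex cyclotomic
polynomial (`|(ℤ/n)ˣ| = φ(n) = 2(k+1)`).
research route conditional on HC_CM; not a corollary; Q11.4-sentence-2 already refuted in dim ≥ 3. [folklore] -/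
theorem im_toCircle_pow_mul_inv_eval_derivative_neg_iff (hn : 1 < n) {k : ℕ}
    (hg : Nat.totient n = 2 * (k + 1)) {t : ZMod n} (ht : t.val.Coprime n) :
    ((𝐞 t) ^ k * (eval (𝐞 t) (derivative (cyclotomic n ℂ)))⁻¹).im < 0 ↔ Even (below t) := by
  rw [eval_derivative_cyclotomic_toCircle ht]
  exact im_toCircle_pow_mul_inv_prod_neg_iff hn (by rw [card_unitsFilter_eq_totient, hg])
    (mem_filter.mpr ⟨mem_univ _, ht⟩)

/-- **The value is purely imaginary** (through Euler's formula): `𝐞(t)^{g−1}·Φₙ′(𝐞(t))⁻¹ = i·r` with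
`r = (2^{2g−1}·P_t)⁻¹ ∈ ℝ`.
research route conditional on HC_CM; not a corollary; Q11.4-sentence-2 already refuted in dim ≥ 3. [folklore] -/
theorem exists_toCircle_pow_mul_inv_eval_derivative_eq_I_mul (hn : 1 < n) {k : ℕ}
    (hg : Nat.totient n = 2 * (k + 1)) {t : ZMod n} (ht : t.val.Coprime n) :
    ∃ r : ℝ, (𝐞 t) ^ k * (eval (𝐞 t) (derivative (cyclotomic n ℂ)))⁻¹ = I * (r : ℂ) := by
  rw [eval_derivative_cyclotomic_toCircle ht,
    toCircle_pow_mul_inv_prod hn (by rw [card_unitsFilter_eq_totient, hg]) (mem_filter.mpr ⟨mem_univ _, ht⟩)]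
  exact ⟨_, rfl⟩

end Summit.HodgeConjecture.Ring2WeilCoverage.CyclotomicSkewSigns

end
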